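import Mathlib
import Summits.MatrixMultiplication.MatrixMultiplication.Theorems.GradedDesignFamily.Negative.FlatFrameDim

/-!
# Restricting the real frame space of `GL₂(K)` to `Γ`: `ρ + dim W ≤ Q³ + Q²`
# (crux `LevelGradedCohnUmans.GradedDesignFamily`, stmt-MatrixMultiplication-7610; negative side,
# line `quadratic-extension-level-one-cell`, stub `gl2Flat_restrict_finrank_le`)

For a finite field `K` (`Q = |K|`) let `ind_(u,w) : GL₂(K) → ℝ`, `g ↦ [g·u = w]`
(`(u, w) ∈ K² × K²`) be the real level-one indicator functions and `F` their real span.  For a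
finset `Γ ⊆ GL₂(K)` let `ρ` be the dimension of the real span `R` of the restricted indicators
`x ↦ [x·u = w]` on the subtype `↥Γ`.  We prove

* `gl2Flat_restrict_finrank_le` — for every real subspace `W ≤ F` all of whose members vanish
  on `Γ`, `ρ + dim W ≤ Q³ + Q²`.

Proof: let `res : (GL₂(K) → ℝ) →ₗ[ℝ] (↥Γ → ℝ)` be the restriction map (`LinearMap.funLeft`).
Then `R = F.map res` (`Submodule.map_span`, `Set.range_comp`).  Rank–nullity for
`r := res.domRestrict F` (`LinearMap.finrank_range_add_finrank_ker`, `LinearMap.range_domRestrict`)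
gives `finrank (F.map res) + finrank (ker r) = finrank F`, and `W` (viewed inside `F` via
`Submodule.comapSubtypeEquivOfLe`) lies in `ker r` because its members vanish on `Γ`
(`Submodule.finrank_mono`).  Finally `finrank F ≤ Q³ + Q²` is the landed
`gl2Flat_real_frame_dim` (`FlatFrameDim.lean`).

Sorry-free; axioms `propext`, `Classical.choice`, `Quot.sound`.
-/

set_option linter.dupNamespace false

open scoped BigOperators

namespace Summit.MatrixMultiplication.MatrixMultiplication.Theorems.GradedDesignFamily.Negative

/-- Rank–nullity bookkeeping: if `W ≤ F` are submodules of a finite-dimensional real space `V`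
and a linear map `res` kills every member of `W`, then
`finrank (F.map res) + finrank W ≤ finrank F`. [folklore] -/
theorem gl2Flat_restrict_finrank_le_aux {V V₂ : Type} [AddCommGroup V] [Module ℝ V]
    [AddCommGroup V₂] [Module ℝ V₂] [FiniteDimensional ℝ V] (res : V →ₗ[ℝ] V₂)
    (F W : Submodule ℝ V) (hWF : W ≤ F) (hvan : ∀ f ∈ W, res f = 0) :
    Module.finrank ℝ (F.map res) + Module.finrank ℝ W ≤ Module.finrank ℝ F := by
  -- rank–nullity for the restriction of `res` to `F`
  have hrn := LinearMap.finrank_range_add_finrank_ker (res.domRestrict F)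
  rw [LinearMap.range_domRestrict] at hrn
  -- `W`, viewed inside `F`, lies in the kernel
  have hle : W.comap F.subtype ≤ LinearMap.ker (res.domRestrict F) := by
    intro f hf
    rw [LinearMap.mem_ker, LinearMap.domRestrict_apply]
    exact hvan _ hf
  have hW : Module.finrank ℝ W ≤ Module.finrank ℝ (LinearMap.ker (res.domRestrict F)) := by
    rw [← (Submodule.comapSubtypeEquivOfLe hWF).finrank_eq]
    exact Submodule.finrank_mono hle
  omega

/-- **B5c `gl2Flat_restrict_finrank_le`** (registered stub of line
`quadratic-extension-level-one-cell`, crux `LevelGradedCohnUmans.GradedDesignFamily`).  For a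
finite field `K` (`Q = |K|`), a finset `Γ ⊆ GL₂(K)` and a real subspace `W` of the real frame space
`F = span {g ↦ [g·u = w]}` all of whose members vanish on `Γ`: the dimension `ρ` of the real span
of the indicators restricted to `↥Γ` satisfies `ρ + dim W ≤ Q³ + Q²` — rank–nullity for the
restriction map on `F` (`gl2Flat_restrict_finrank_le_aux`) plus `dim F ≤ Q³ + Q²`
(`gl2Flat_real_frame_dim`). [folklore] -/
theorem gl2Flat_restrict_finrank_le : ∀ {K : Type} [Field K] [Fintype K] [DecidableEq K]
    (Γ : Finset (Matrix.GeneralLinearGroup (Fin 2) K))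
    (W : Submodule ℝ (Matrix.GeneralLinearGroup (Fin 2) K → ℝ)),
    W ≤ Submodule.span ℝ (Set.range fun p : (Fin 2 → K) × (Fin 2 → K) =>
        fun g : Matrix.GeneralLinearGroup (Fin 2) K =>
          if (g : Matrix (Fin 2) (Fin 2) K).mulVec p.1 = p.2 then (1 : ℝ) else 0) →
    (∀ f ∈ W, ∀ x ∈ Γ, f x = 0) →
    Module.finrank ℝ (Submodule.span ℝ (Set.range fun p : (Fin 2 → K) × (Fin 2 → K) =>
          fun x : {x // x ∈ Γ} =>
            if ((x : Matrix.GeneralLinearGroup (Fin 2) K) : Matrix (Fin 2) (Fin 2) K).mulVec p.1 = p.2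
            then (1 : ℝ) else 0)) + Module.finrank ℝ W ≤
      Fintype.card K ^ 3 + Fintype.card K ^ 2 := by
  intro K _ _ _ Γ W hWF hvan
  -- the restricted span is the image of the frame space under the restriction map
  have hmap : Submodule.span ℝ (Set.range fun p : (Fin 2 → K) × (Fin 2 → K) =>
        fun x : {x // x ∈ Γ} =>
          if ((x : Matrix.GeneralLinearGroup (Fin 2) K) : Matrix (Fin 2) (Fin 2) K).mulVec p.1 = p.2
          then (1 : ℝ) else 0) =
      (Submodule.span ℝ (Set.range fun p : (Fin 2 → K) × (Fin 2 → K) =>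
        fun g : Matrix.GeneralLinearGroup (Fin 2) K =>
          if (g : Matrix (Fin 2) (Fin 2) K).mulVec p.1 = p.2 then (1 : ℝ) else 0)).map
        (LinearMap.funLeft ℝ ℝ
          (fun x : {x // x ∈ Γ} => (x : Matrix.GeneralLinearGroup (Fin 2) K))) := by
    rw [Submodule.map_span, ← Set.range_comp]
    rfl
  rw [hmap]
  refine (gl2Flat_restrict_finrank_le_aux _ _ W hWF fun f hf => ?_).trans
    (gl2Flat_real_frame_dim K)
  funext x
  exact hvan f hf x x.2

end Summit.MatrixMultiplication.MatrixMultiplication.Theorems.GradedDesignFamily.Negative
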